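import Literature.NumberTheory.Automorphic.ShimuraCurveRibetTakahashiPeterssonConvexityProofs
import Mathlib.NumberTheory.EulerProduct.DirichletLSeries
import HarnessLib

/-!
# The Phragmén–Lindelöf upper bound for the Petersson norm of the newform of a semistable
# elliptic curve with Mai–Murty's exponent: `(f, f)_{Γ₀(N)} ≤ C · N · (1 + log N)³`, `N` squarefree

Topic `NumberTheory/Automorphic`; a proofs-only companion (theorems only: no definition, no named
fact) of `ShimuraCurveRibetTakahashi.lean`, sequel to
`ShimuraCurveRibetTakahashiPeterssonConvexityProofs.lean`, for the named fact
`murty_petersson_newform_upper_bound` (`Re (f,f) ≤ C · N · log N` for the newform of every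
elliptic curve over `ℚ`; [MurtyCongruencePrimes1999], §2; [PastenShimura2024], p. 49). The
exponent `1` of that statement is not established in the literature (see the fact's caveat); the
proof it cites, [MaiMurty1994], §2, is the Phragmén–Lindelöf convexity argument and prints
"`L(1, Sym²(f)) = O((log N)³)`", i.e. `(f,f) ≪ N (log N)³`. The prequel proved that argument on the
tree's Rankin–Selberg continuation with exponent `5`; this file sharpens the bookkeeping on the line
of absolute convergence and PROVES, for every squarefree level, **Mai–Murty's printed exponent `3`**:

* `exists_petersson_le_mul_log_cube_of_squarefree` — **an absolute `C > 0` with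
  `Re (f, f)_{Γ₀(N)} ≤ C · N · (1 + log N)³` for every squarefree `N`, every elliptic curve `E/ℚ` and
  every `f ∈ S₂(Γ₀(N))` with `IsNewformOf E f`** (`C = 2·3⁵·(7/3)⁵·16·e·4³`);
* `exists_petersson_le_mul_log_pow_three_of_squarefree` — `≤ C · N · (log N)³` for `N ≥ 3` (the
  shape of the named fact with the exponent its source proves);
* `exists_log_petersson_le_three_of_squarefree` — `log Re (f,f) ≤ log N + 3 log log N + C`;
* `exists_petersson_le_mul_rpow_of_squarefree` — `≤ C · N^{1+ε}/ε³` for all `0 < ε ≤ 1` (the form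
  `(f,f) ≪_ε N^{1+ε}` in which the `abc` routes consume the bound; Murty's displayed
  `log (f,f) < (1+ε) log N`);
* `exists_petersson_le_mul_log_cube_of_forall_prime_sq_not_dvd` — the same with the semistability
  hypothesis spelled `∀ p prime, p² ∤ N`.

## The printed proof and the proof here

[MaiMurty1994], §2 applies Rademacher's Phragmén–Lindelöf theorem (Proposition: an Euler product of
degree `d` with unitary local roots, entire continuation and functional equation of conductor `A`
satisfies `|L(σ+it)| ≪ (A(|t|+2)^d)^{(1−σ)/2}(log(A(|t|+2)^d))^d`, `0 ≤ σ ≤ 1`; its proof bounds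
`|L(1+δ+it)| ≤ ζ(1+δ)^d` by hypothesis (ii) and reflects by the functional equation) to
`L(s, Sym² f)`, `d = 3`, `log A = O(log N)` (Shimura 1975), getting `L(1, Sym² f) = O((log N)³)`,
and concludes by the Rankin–Selberg display `L(1, Sym² f) = c ∏(…) ⟨f,f⟩/N`. The tree has no
continuation of `L(s, Sym² f)` alone, but (prequel) the completed trace zeta function
`Z_f(s) = s(s−1)∫_𝒟 G_f E₀*(·,s) dμ + V/2`, `V = Re (f,f)`, entire with `Z_f(1−s) = Z_f(s)`,
`Z_f(1) = V/2`, of finite order in the strip, and equal for squarefree `N` and `Re s > 1` to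
`s(s−1)π^{-s}Γ(s)ζ(2s)Γ(s+1)(4π/N)^{-(s+1)} (N⁻¹Σ_{c∣N}c^{-s}) Σₙ|aₙ|²n^{-(s+1)}`
(`IsNewform0.traceZeta_eq_of_squarefree`). The new input is the exact Euler factorisation of the
last two factors at a COMPLEX point (§§1–2):
1. `Σₙ|aₙ|²n^{-(s+1)} = ∏_p T_p(s)` (`IsNewform0.hasProd_LSeries_normSq`), with, at `p ∤ N`,
   `T_p = (1 + p^{-s}) · ((1 − p^{-s})(1 − α_p²p^{-1-s})(1 − β_p²p^{-1-s}))⁻¹` — the squares of the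
   Hecke recursion satisfy the ternary recursion with roots `α², αβ, β²`
   (`tsum_sq_mul_pow_mul_cubic_eq`, the complex twin of the tree's
   `IsNewform0.tsum_normSq_cuspCoeff_prime_pow_mul_eq`) and `|α_p²| = |β_p²| = p` by Hasse
   (`exists_roots_symmSq_quadratic`), whence `|T_p| ≤ |1 + p^{-s}| (1 − p^{-σ})⁻³`; at `p ∣ N`
   (so `p ∥ N`), `|a_{p^e}|² = 1` and `|T_p| ≤ (1 − p^{-σ-1})⁻¹`;
2. `N` squarefree: `Σ_{c∣N}c^{-s} = ∏_{p∣N}(1 + p^{-s})` COMPLETES `∏_{p∤N}(1 + p^{-s})` to the full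
   `∏_p(1 + p^{-s})`, and `|1 + p^{-s}| ≤ (1 + p^{-2σ})|1 − p^{-s}|⁻¹` with `∏_p|1 − p^{-s}|⁻¹ = |ζ(s)|`
   (Mathlib's `riemannZeta_eulerProduct_hasProd`): altogether
   `|(Σ_{c∣N}c^{-s}) Σ|aₙ|²n^{-(s+1)}| ≤ ζ(2σ)ζ(σ)³ζ(σ+1) |ζ(s)|`
   (`IsNewformOf.norm_sum_divisors_mul_LSeries_le`) — three real factors `ζ(σ) ≍ 1/δ`, the degree
   of `Sym² f`, and the pole factor kept complex;
3. (§3) `|(s−1)ζ(s)| ≤ 2|s+2|²/|s−1|·…`: precisely `|s−1||ζ(s)| ≤ 2|s+2|²` on `Re s ≥ 1`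
   (Titchmarsh (2.12.2), tree), so on `Re s = 1+δ`: `|Z_f(s)| ≤ 16 N^{1+δ}ζ(1+δ)³|s+2|⁵`; the same
   on `Re s = −δ` up to `(7/3)⁵`; Rademacher's theorem (`rademacher_phragmenLindelof_of_finiteOrder`)
   gives `V/2 = Z_f(1) ≤ 3⁵(7/3)⁵·16N^{1+δ}ζ(1+δ)³`, and `δ = 1/(2 + log N)` (`N^δ ≤ e`,
   `ζ(1+δ) ≤ 4 + log N`) yields the theorem.
So the only differences from the printed proof are the carrier of the continuation (the trace zeta
function of the tree instead of Shimura's `L(s, Sym² f)`) and hence the restriction to squarefree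
`N` (for `p² ∣ N` the trace picks up the other cusps' twisted series, not in the tree). All inputs
are theorems of the tree and Mathlib; nothing below depends on a named fact.

## References

* [MaiMurty1994] L. Mai, M. R. Murty, *The Phragmén–Lindelöf theorem and modular elliptic
  curves*, Contemp. Math. 166 (1994), 335–340, §2: Rademacher's Proposition and its hypothesis
  (ii) `|L(s)| ≤ ζ(σ)^d`; "Hence, by Rademacher's version of the Phragmén–Lindelöf,
  `L(1, Sym²(f)) = O((log N)³)`"; "Proposition. `log⟨f,f⟩ = O(log N)`".
* [Rademacher1959] H. Rademacher, Math. Z. 72 (1959), 192–204, Thm. 2.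
* [Rankin1939] R. A. Rankin, Proc. Cambridge Philos. Soc. 35 (1939), 357–372, §4.
* [AtkinLehner1970] A. O. L. Atkin, J. Lehner, Math. Ann. 185 (1970), Thm. 3.
* [Titchmarsh1986] E. C. Titchmarsh, *The theory of the Riemann zeta-function*, 2nd ed., (2.12.2).
* [MurtyCongruencePrimes1999] M. R. Murty, *Bounds for congruence primes*, Proc. Sympos. Pure
  Math. 66.1 (1999), §2 ("`(f,f) ≤ c₂ N log N`", citing [MM]; `(1−ε)log N < log(f,f) < (1+ε)log N`).
* [PastenShimura2024] H. Pasten, *Shimura curves and the abc conjecture*, J. Number Theory 254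
  (2024) = arXiv:1705.09251, §16, p. 49 ("`‖f‖² ≪ N log N` which gives
  `2 log ‖f‖ ≤ log N + O(log log N)`").
* J. H. Silverman, *The Arithmetic of Elliptic Curves*, Thm. V.1.1 (Hasse).
-/

noncomputable section

open scoped Real Topology MatrixGroups ModularForm
open Filter Complex Set MeasureTheory CongruenceSubgroup

namespace Literature.NumberTheory.Automorphic

open Literature.NumberTheory.EllipticCurves.ModularForms
open Literature.NumberTheory.LFunctions

/-! ### 1. Local algebra: the symmetric-square Euler factor at a complex point -/

section Local

/-- `‖(1 − w)⁻¹‖ ≤ (1 − ‖w‖)⁻¹` for `‖w‖ < 1`. [folklore] -/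
theorem norm_inv_one_sub_le {w : ℂ} (hw : ‖w‖ < 1) : ‖(1 - w)⁻¹‖ ≤ (1 - ‖w‖)⁻¹ := by
  have h1 : 1 - ‖w‖ ≤ ‖1 - w‖ := by
    have := norm_sub_norm_le (1 : ℂ) w
    rw [norm_one] at this
    linarith
  rw [norm_inv]
  exact inv_anti₀ (by linarith) h1

/-- `‖1 + w‖ ≤ (1 + ‖w‖²) ‖(1 − w)⁻¹‖` for `‖w‖ < 1` (`(1 + w)(1 − w) = 1 − w²`): the factor
`1 + p^{-s}` of the Rankin–Selberg Euler factor is `(1 − p^{-2s})(1 − p^{-s})⁻¹`, a bounded factor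
times the Euler factor of `ζ(s)`. [folklore] -/
theorem norm_one_add_le_mul_norm_inv_one_sub {w : ℂ} (hw : ‖w‖ < 1) :
    ‖1 + w‖ ≤ (1 + ‖w‖ ^ 2) * ‖(1 - w)⁻¹‖ := by
  have hne : (1 : ℂ) - w ≠ 0 := by
    intro h
    have : w = 1 := (sub_eq_zero.mp h).symm
    rw [this, norm_one] at hw
    exact lt_irrefl _ hw
  have heq : (1 : ℂ) + w = (1 - w ^ 2) * (1 - w)⁻¹ := by
    field_simp
    ring
  rw [heq, norm_mul]
  gcongr
  calc ‖(1 : ℂ) - w ^ 2‖ ≤ ‖(1 : ℂ)‖ + ‖w ^ 2‖ := norm_sub_le _ _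
    _ = 1 + ‖w‖ ^ 2 := by rw [norm_one, norm_pow]

/-- **Squares of a binary linear recurrence, complex generating function.** If `u₀ = 1`, `u₁ = a`,
`u_{e+2} = a u_{e+1} − q u_e` (`a, q ∈ ℝ`), then for every complex `x` at which `Σ u_e² xᵉ`
converges, `(Σ_e u_e² xᵉ) · (1 − q x)(1 − (a² − 2q) x + q² x²) = 1 + q x` (the squares satisfy the
ternary recurrence with characteristic roots `α², αβ = q, β²`, `α + β = a`, `αβ = q`). The real case
is the tree's `IsNewform0.tsum_normSq_cuspCoeff_prime_pow_mul_eq`; the same proof, verbatim over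
`ℂ`. [folklore] -/
theorem tsum_sq_mul_pow_mul_cubic_eq {u : ℕ → ℝ} {a q : ℝ} (hu0 : u 0 = 1) (hu1 : u 1 = a)
    (hrec : ∀ e, u (e + 2) = a * u (e + 1) - q * u e) {x : ℂ}
    (hs : Summable fun e : ℕ ↦ ((u e : ℂ)) ^ 2 * x ^ e) :
    (∑' e : ℕ, ((u e : ℂ)) ^ 2 * x ^ e) *
        ((1 - q * x) * (1 - ((a ^ 2 - 2 * q : ℝ) : ℂ) * x + (q : ℂ) ^ 2 * x ^ 2)) =
      1 + q * x := by
  -- complex copies of the data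
  set v : ℕ → ℂ := fun e ↦ (u e : ℂ) with hv
  have hv0 : v 0 = 1 := by simp [hv, hu0]
  have hv1 : v 1 = a := by simp [hv, hu1]
  have hvrec : ∀ e, v (e + 2) = a * v (e + 1) - q * v e := fun e ↦ by
    simp only [hv, hrec e]; push_cast; ring
  have hv2 : v 2 = a ^ 2 - q := by
    have h := hvrec 0
    rw [zero_add, zero_add, hv0, hv1, mul_one] at h
    rw [h]; ring
  -- the order-three recursion for the squares (roots `α², αβ = q, β²`)
  have hsq : ∀ e, v (e + 3) ^ 2 =
      (a ^ 2 - q) * v (e + 2) ^ 2 - (q * a ^ 2 - (q : ℂ) ^ 2) * v (e + 1) ^ 2 +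
        (q : ℂ) ^ 3 * v e ^ 2 := by
    intro e
    have h2 : v (e + 2) = a * v (e + 1) - q * v e := hvrec e
    have h3 : v (e + 3) = a * v (e + 2) - q * v (e + 1) := hvrec (e + 1)
    rw [h3, h2]
    ring
  change (∑' e : ℕ, v e ^ 2 * x ^ e) * _ = _
  have hs' : Summable fun e : ℕ ↦ v e ^ 2 * x ^ e := hs
  obtain ⟨S, hS⟩ : ∃ S : ℂ, HasSum (fun e : ℕ ↦ v e ^ 2 * x ^ e) S := ⟨_, hs'.hasSum⟩
  rw [hS.tsum_eq]
  -- shifted sums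
  have h1 : HasSum (fun e : ℕ ↦ v (e + 1) ^ 2 * x ^ (e + 1))
      (S - ∑ i ∈ Finset.range 1, v i ^ 2 * x ^ i) := (hasSum_nat_add_iff' 1).mpr hS
  have h2 : HasSum (fun e : ℕ ↦ v (e + 2) ^ 2 * x ^ (e + 2))
      (S - ∑ i ∈ Finset.range 2, v i ^ 2 * x ^ i) := (hasSum_nat_add_iff' 2).mpr hS
  have h3 : HasSum (fun e : ℕ ↦ v (e + 3) ^ 2 * x ^ (e + 3))
      (S - ∑ i ∈ Finset.range 3, v i ^ 2 * x ^ i) := (hasSum_nat_add_iff' 3).mpr hS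
  -- the recursion inside the third shifted sum
  have hfun : (fun e : ℕ ↦ v (e + 3) ^ 2 * x ^ (e + 3)) = fun e : ℕ ↦
      (a ^ 2 - q) * x * (v (e + 2) ^ 2 * x ^ (e + 2)) -
        (q * a ^ 2 - (q : ℂ) ^ 2) * x ^ 2 * (v (e + 1) ^ 2 * x ^ (e + 1)) +
        (q : ℂ) ^ 3 * x ^ 3 * (v e ^ 2 * x ^ e) := by
    funext e
    rw [hsq e]
    ring
  have h3' : HasSum (fun e : ℕ ↦ v (e + 3) ^ 2 * x ^ (e + 3))
      ((a ^ 2 - q) * x * (S - ∑ i ∈ Finset.range 2, v i ^ 2 * x ^ i) -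
        (q * a ^ 2 - (q : ℂ) ^ 2) * x ^ 2 * (S - ∑ i ∈ Finset.range 1, v i ^ 2 * x ^ i) +
        (q : ℂ) ^ 3 * x ^ 3 * S) := by
    rw [hfun]
    exact ((h2.mul_left ((a ^ 2 - q) * x)).sub
      (h1.mul_left ((q * a ^ 2 - (q : ℂ) ^ 2) * x ^ 2))).add (hS.mul_left ((q : ℂ) ^ 3 * x ^ 3))
  have heq := h3.unique h3'
  simp only [Finset.sum_range_succ, Finset.sum_range_zero, zero_add, pow_zero, pow_one, hv0, hv1,
    hv2, one_pow, one_mul] at heq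
  push_cast
  linear_combination heq

/-- **The roots of the symmetric-square quadratic have modulus `p`.** For real `0 ≤ A ≤ 4p`
(`A = a_p²`, Hasse) there are `γ₁, γ₂ ∈ ℂ` with `‖γ₁‖ = ‖γ₂‖ = p` and
`1 − (A − 2p) x + p² x² = (1 − γ₁ x)(1 − γ₂ x)` (`γ = α², β²` with `α + β = a_p`, `αβ = p`,
`|α| = |β| = √p`). [folklore] -/
theorem exists_roots_symmSq_quadratic {A p : ℝ} (hA0 : 0 ≤ A) (hA : A ≤ 4 * p) (hp : 0 ≤ p) :
    ∃ γ₁ γ₂ : ℂ, ‖γ₁‖ = p ∧ ‖γ₂‖ = p ∧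
      ∀ x : ℂ, (1 : ℂ) - ((A - 2 * p : ℝ) : ℂ) * x + (p : ℂ) ^ 2 * x ^ 2 =
        (1 - γ₁ * x) * (1 - γ₂ * x) := by
  set r : ℝ := Real.sqrt (A * (4 * p - A)) with hr
  have hr2 : r ^ 2 = A * (4 * p - A) := by
    rw [hr, Real.sq_sqrt (mul_nonneg hA0 (by linarith))]
  refine ⟨⟨(A - 2 * p) / 2, r / 2⟩, ⟨(A - 2 * p) / 2, -(r / 2)⟩, ?_, ?_, fun x ↦ ?_⟩
  · rw [Complex.norm_def, Complex.normSq_mk]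
    rw [show (A - 2 * p) / 2 * ((A - 2 * p) / 2) + r / 2 * (r / 2) = p ^ 2 by nlinarith [hr2]]
    exact Real.sqrt_sq hp
  · rw [Complex.norm_def, Complex.normSq_mk]
    rw [show (A - 2 * p) / 2 * ((A - 2 * p) / 2) + -(r / 2) * -(r / 2) = p ^ 2 by nlinarith [hr2]]
    exact Real.sqrt_sq hp
  · have hsum : (⟨(A - 2 * p) / 2, r / 2⟩ : ℂ) + ⟨(A - 2 * p) / 2, -(r / 2)⟩ = ((A - 2 * p : ℝ) : ℂ) := by
      apply Complex.ext <;> norm_num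
    have hprod : (⟨(A - 2 * p) / 2, r / 2⟩ : ℂ) * ⟨(A - 2 * p) / 2, -(r / 2)⟩ = (p : ℂ) ^ 2 := by
      rw [← Complex.ofReal_pow]
      apply Complex.ext
      · simp only [Complex.mul_re, Complex.ofReal_re]
        nlinarith [hr2]
      · simp only [Complex.mul_im, Complex.ofReal_im]
        ring
    calc (1 : ℂ) - ((A - 2 * p : ℝ) : ℂ) * x + (p : ℂ) ^ 2 * x ^ 2
        = 1 - ((⟨(A - 2 * p) / 2, r / 2⟩ : ℂ) + ⟨(A - 2 * p) / 2, -(r / 2)⟩) * x +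
            ((⟨(A - 2 * p) / 2, r / 2⟩ : ℂ) * ⟨(A - 2 * p) / 2, -(r / 2)⟩) * x ^ 2 := by
          rw [hsum, hprod]
      _ = _ := by ring

variable {N : ℕ} [NeZero N] {W : WeierstrassCurve ℚ} [W.IsElliptic] {f : CuspForm (Gamma0 N) 2}

/-- Hasse at `p`: `‖a_p(f)‖² ≤ 4p` for the newform `f` of `E/ℚ` (`a_p(f) = a_p(E)`,
`WeierstrassCurve.abs_LFunction_prime_pow_le` with `k = 1`). [folklore] -/
theorem _root_.Literature.NumberTheory.EllipticCurves.ModularForms.IsNewformOf.normSq_cuspCoeff_prime_le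
    (hf : IsNewformOf W f) {p : ℕ} (hp : p.Prime) : ‖cuspCoeff f p‖ ^ 2 ≤ 4 * p := by
  have h := W.abs_LFunction_prime_pow_le hp 1
  rw [pow_one, pow_one] at h
  have hnorm : ‖cuspCoeff f p‖ = |(W.LFunction p : ℝ)| := by
    rw [hf.2 p, Complex.norm_intCast]
  have hp0 : (0 : ℝ) ≤ p := Nat.cast_nonneg p
  have h0 : 0 ≤ ((1 : ℝ) + 1) * Real.sqrt p := by positivity
  calc ‖cuspCoeff f p‖ ^ 2 = |(W.LFunction p : ℝ)| ^ 2 := by rw [hnorm]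
    _ ≤ (((1 : ℝ) + 1) * Real.sqrt p) ^ 2 := pow_le_pow_left₀ (abs_nonneg _) (by exact_mod_cast h) 2
    _ = 4 * p := by rw [mul_pow, Real.sq_sqrt hp0]; ring

/-- **The good Euler factor of `Σ |aₙ|² n^{-s}` at a complex point, bounded by the degree-`3`
majorant.** For the newform `f` of `E/ℚ`, a prime `p ∤ N` and complex `x` with `‖x‖ < 1/p` at which
`Σ_e ‖a_{p^e}‖² xᵉ` converges,
`‖Σ_e ‖a_{p^e}‖² xᵉ‖ ≤ ‖1 + p x‖ · (1 − p‖x‖)⁻³`: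
`Σ_e a_{p^e}² xᵉ = (1 + p x)/((1 − p x)(1 − α²x)(1 − β²x))` (`tsum_sq_mul_pow_mul_cubic_eq`,
`exists_roots_symmSq_quadratic`) with `|α²| = |β²| = p` by Hasse. This is hypothesis (ii)
(`|L(s)| ≤ ζ(σ)^d` on `σ > 1`, `d = 3`) of Rademacher's Proposition in [MaiMurty1994], §2, for the
symmetric square — with the factor `1 + p^{-s}` kept complex. [cite: MaiMurty1994, §2 (Proposition, hypothesis (ii), d = 3)] -/
theorem _root_.Literature.NumberTheory.EllipticCurves.ModularForms.IsNewformOf.norm_tsum_normSq_mul_pow_le_of_not_dvd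
    (hf : IsNewformOf W f) {p : ℕ} (hp : p.Prime) (hpN : ¬ p ∣ N) {x : ℂ} (hx : p * ‖x‖ < 1)
    (hs : Summable fun e : ℕ ↦ (((‖cuspCoeff f (p ^ e)‖ ^ 2 : ℝ)) : ℂ) * x ^ e) :
    ‖∑' e : ℕ, (((‖cuspCoeff f (p ^ e)‖ ^ 2 : ℝ)) : ℂ) * x ^ e‖ ≤
      ‖1 + p * x‖ * ((1 - p * ‖x‖)⁻¹) ^ 3 := by
  have hp0 : (0 : ℝ) ≤ p := Nat.cast_nonneg p
  -- real coefficients and the recursion at the good prime `p`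
  set u : ℕ → ℝ := fun e ↦ (cuspCoeff f (p ^ e)).re with hu
  have hc : ∀ e, (((‖cuspCoeff f (p ^ e)‖ ^ 2 : ℝ)) : ℂ) = ((u e : ℂ)) ^ 2 := fun e ↦ by
    rw [hf.1.norm_cuspCoeff_sq]; push_cast; rfl
  have hu0 : u 0 = 1 := by simp only [hu, pow_zero]; exact hf.1.re_cuspCoeff_one
  have hrec : ∀ e, u (e + 2) = u 1 * u (e + 1) - p * u e := fun e ↦ by
    have h := hf.1.re_cuspCoeff_prime_pow_add_two hp e
    simp only [if_neg hpN] at h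
    simp only [hu]
    rw [pow_one]
    exact h
  have hs' : Summable fun e : ℕ ↦ ((u e : ℂ)) ^ 2 * x ^ e := by
    refine hs.congr fun e ↦ ?_
    rw [hc e]
  have hT : (∑' e : ℕ, (((‖cuspCoeff f (p ^ e)‖ ^ 2 : ℝ)) : ℂ) * x ^ e) =
      ∑' e : ℕ, ((u e : ℂ)) ^ 2 * x ^ e := tsum_congr fun e ↦ by rw [hc e]
  have hid := tsum_sq_mul_pow_mul_cubic_eq (a := u 1) (q := (p : ℝ)) hu0 rfl hrec hs'
  -- Hasse: `u 1 ^ 2 = ‖a_p‖² ≤ 4p`, so the quadratic has roots of modulus `p`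
  have hA : u 1 ^ 2 = ‖cuspCoeff f p‖ ^ 2 := by
    rw [hf.1.norm_cuspCoeff_sq]
    simp [hu]
  have hA4 : u 1 ^ 2 ≤ 4 * p := hA ▸ hf.normSq_cuspCoeff_prime_le hp
  obtain ⟨γ₁, γ₂, hγ₁, hγ₂, hfac⟩ := exists_roots_symmSq_quadratic (sq_nonneg (u 1)) hA4 hp0
  simp only [Complex.ofReal_natCast] at hid hfac
  -- the three linear factors are invertible, with inverses bounded by `(1 − p‖x‖)⁻¹`
  have hlt : ∀ γ : ℂ, ‖γ‖ = p → ‖γ * x‖ < 1 := fun γ hγ ↦ by rwa [norm_mul, hγ]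
  have hpx : ‖(p : ℂ) * x‖ < 1 := hlt p (by rw [Complex.norm_natCast])
  have hne : ∀ w : ℂ, ‖w‖ < 1 → (1 : ℂ) - w ≠ 0 := fun w hw h ↦ by
    have : w = 1 := (sub_eq_zero.mp h).symm
    rw [this, norm_one] at hw
    exact lt_irrefl _ hw
  have hbd : ∀ γ : ℂ, ‖γ‖ = p → ‖(1 - γ * x)⁻¹‖ ≤ (1 - p * ‖x‖)⁻¹ := fun γ hγ ↦ by
    have h := norm_inv_one_sub_le (hlt γ hγ)
    rwa [norm_mul, hγ] at h
  have hQ : ((1 : ℂ) - p * x) * (1 - (((u 1 ^ 2 - 2 * p : ℝ)) : ℂ) * x + (p : ℂ) ^ 2 * x ^ 2) =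
      (1 - p * x) * ((1 - γ₁ * x) * (1 - γ₂ * x)) := by rw [hfac x]
  have hQne : ((1 : ℂ) - p * x) * ((1 - γ₁ * x) * (1 - γ₂ * x)) ≠ 0 :=
    mul_ne_zero (hne _ hpx) (mul_ne_zero (hne _ (hlt γ₁ hγ₁)) (hne _ (hlt γ₂ hγ₂)))
  have hTeq : (∑' e : ℕ, ((u e : ℂ)) ^ 2 * x ^ e) =
      (1 + p * x) * ((1 - p * x)⁻¹ * ((1 - γ₁ * x)⁻¹ * (1 - γ₂ * x)⁻¹)) := by
    rw [hQ] at hid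
    have := (eq_div_iff hQne).mpr hid
    rw [this, div_eq_mul_inv, mul_inv, mul_inv]
  have h0 : 0 ≤ (1 - p * ‖x‖)⁻¹ := inv_nonneg.mpr (by linarith)
  rw [hT, hTeq, norm_mul, norm_mul, norm_mul]
  have hp' : ‖(1 - (p : ℂ) * x)⁻¹‖ ≤ (1 - p * ‖x‖)⁻¹ := hbd p (by rw [Complex.norm_natCast])
  have hB : ‖(1 - (p : ℂ) * x)⁻¹‖ * (‖(1 - γ₁ * x)⁻¹‖ * ‖(1 - γ₂ * x)⁻¹‖) ≤
      (1 - p * ‖x‖)⁻¹ * ((1 - p * ‖x‖)⁻¹ * (1 - p * ‖x‖)⁻¹) :=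
    mul_le_mul hp' (mul_le_mul (hbd γ₁ hγ₁) (hbd γ₂ hγ₂) (norm_nonneg _) h0)
      (mul_nonneg (norm_nonneg _) (norm_nonneg _)) h0
  calc ‖1 + (p : ℂ) * x‖ * (‖(1 - (p : ℂ) * x)⁻¹‖ * (‖(1 - γ₁ * x)⁻¹‖ * ‖(1 - γ₂ * x)⁻¹‖))
      ≤ ‖1 + (p : ℂ) * x‖ * ((1 - p * ‖x‖)⁻¹ * ((1 - p * ‖x‖)⁻¹ * (1 - p * ‖x‖)⁻¹)) :=
        mul_le_mul_of_nonneg_left hB (norm_nonneg _)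
    _ = ‖1 + (p : ℂ) * x‖ * ((1 - p * ‖x‖)⁻¹) ^ 3 := by ring

/-- **The bad Euler factor at `p ∥ N`** (`p ∣ N`, `p² ∤ N`; every `p ∣ N` for squarefree `N`):
`‖Σ_e ‖a_{p^e}‖² xᵉ‖ ≤ (1 − ‖x‖)⁻¹` for `‖x‖ < 1` (`‖a_{p^e}‖² = 1`, Atkin–Lehner).
[cite: AtkinLehner1970, Thm. 3] -/
theorem _root_.Literature.NumberTheory.EllipticCurves.ModularForms.IsNewform0.norm_tsum_normSq_mul_pow_le_of_dvd
    (hf : IsNewform0 f) {p : ℕ} (hp : p.Prime) (hpN : p ∣ N) (hp2 : ¬ p ^ 2 ∣ N) {x : ℂ}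
    (hx : ‖x‖ < 1) :
    ‖∑' e : ℕ, (((‖cuspCoeff f (p ^ e)‖ ^ 2 : ℝ)) : ℂ) * x ^ e‖ ≤ (1 - ‖x‖)⁻¹ := by
  have h1 : ∀ e : ℕ, ‖cuspCoeff f (p ^ e)‖ ^ 2 = 1 := fun e ↦ by
    rw [hf.cuspCoeff_prime_pow_of_dvd hp hpN e, norm_pow, ← pow_mul, mul_comm, pow_mul,
      hf.norm_cuspCoeff_sq_of_dvd hp hpN, if_neg hp2, one_pow]
  simp_rw [h1, Complex.ofReal_one, one_mul]
  rw [(hasSum_geometric_of_norm_lt_one hx).tsum_eq]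
  exact norm_inv_one_sub_le hx

end Local

/-! ### 2. The Euler product of `Σ |aₙ|² n^{-w}` at a complex point and the key bound -/

section Euler

variable {N : ℕ} [NeZero N] {W : WeierstrassCurve ℚ} [W.IsElliptic] {f : CuspForm (Gamma0 N) 2}

omit [NeZero N] in
/-- The terms of the `L`-series `Σ |aₙ|² n^{-w}` at prime powers: `|a_{p^e}|² (p^e)^{-w} = |a_{p^e}|² (p^{-w})ᵉ`.
[folklore] -/
theorem term_normSq_prime_pow (f : CuspForm (Gamma0 N) 2) (w : ℂ) {p : ℕ} (hp : p.Prime) (e : ℕ) :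
    LSeries.term (fun n ↦ (((‖cuspCoeff f n‖ ^ 2 : ℝ)) : ℂ)) w (p ^ e) =
      (((‖cuspCoeff f (p ^ e)‖ ^ 2 : ℝ)) : ℂ) * ((p : ℂ) ^ (-w)) ^ e := by
  rw [LSeries.term_of_ne_zero (pow_ne_zero e hp.ne_zero), Nat.cast_pow,
    ← Complex.natCast_cpow_natCast_mul, Complex.cpow_nat_mul, div_eq_mul_inv, ← inv_pow,
    Complex.cpow_neg]

/-- **Euler product of `Σ |aₙ(f)|² n^{-w}` at a complex point `Re w > 2`** for a newform
`f ∈ S₂(Γ₀(N))`: `Σ |aₙ|² n^{-w} = ∏_p Σ_e |a_{p^e}|² p^{-ew}` (multiplicativity of the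
coefficients and absolute convergence in Rankin's range; the real case is the tree's
`IsNewform0.hasProd_tsum_normSq_cuspCoeff_prime_pow`). [cite: Rankin1939, §4 (absolute convergence of Σ|aₙ|²n^{-s}, Re s > 2)] -/
theorem _root_.Literature.NumberTheory.EllipticCurves.ModularForms.IsNewform0.hasProd_LSeries_normSq
    (hf : IsNewform0 f) {w : ℂ} (hw : 2 < w.re) :
    HasProd (fun p : Nat.Primes ↦
        ∑' e : ℕ, (((‖cuspCoeff f ((p : ℕ) ^ e)‖ ^ 2 : ℝ)) : ℂ) * (((p : ℕ) : ℂ) ^ (-w)) ^ e)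
      (LSeries (fun n ↦ (((‖cuspCoeff f n‖ ^ 2 : ℝ)) : ℂ)) w) := by
  set g : ℕ → ℂ := fun n ↦ (((‖cuspCoeff f n‖ ^ 2 : ℝ)) : ℂ) with hg
  have h1 : LSeries.term g w 1 = 1 := by
    rw [LSeries.term_of_ne_zero one_ne_zero, Nat.cast_one, Complex.one_cpow, div_one, hg]
    simp [show cuspCoeff f 1 = 1 from hf.2.2]
  have hmul : ∀ {m n : ℕ}, m.Coprime n →
      LSeries.term g w (m * n) = LSeries.term g w m * LSeries.term g w n := by
    intro m n hmn
    rcases eq_or_ne m 0 with rfl | hm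
    · simp [LSeries.term_zero]
    rcases eq_or_ne n 0 with rfl | hn
    · simp [LSeries.term_zero]
    have hco : cuspCoeff f (m * n) = cuspCoeff f m * cuspCoeff f n :=
      IsNewform0.coeff_mul_of_coprime_holds hf hmn
    rw [LSeries.term_of_ne_zero (mul_ne_zero hm hn), LSeries.term_of_ne_zero hm,
      LSeries.term_of_ne_zero hn, hg]
    simp only
    rw [hco, norm_mul, Nat.cast_mul, Complex.natCast_mul_natCast_cpow, mul_pow]
    push_cast
    rw [mul_div_mul_comm]
  have hsum : Summable fun n ↦ ‖LSeries.term g w n‖ :=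
    summable_norm_iff.mpr (LSeriesSummable_normSq_cuspCoeff f hw)
  have h := EulerProduct.eulerProduct_hasProd h1 hmul hsum (LSeries.term_zero g w)
  refine h.congr_fun fun p ↦ ?_
  exact (tsum_congr fun e ↦ term_normSq_prime_pow f w p.2 e).symm

/-- The prime-power subseries at a complex point converges (`Re w > 2`). [folklore] -/
theorem summable_normSq_cuspCoeff_prime_pow_mul_cpow (f : CuspForm (Gamma0 N) 2) {w : ℂ}
    (hw : 2 < w.re) {p : ℕ} (hp : p.Prime) :
    Summable fun e : ℕ ↦ (((‖cuspCoeff f (p ^ e)‖ ^ 2 : ℝ)) : ℂ) * ((p : ℂ) ^ (-w)) ^ e := by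
  have h := (LSeriesSummable_normSq_cuspCoeff f hw).comp_injective (Nat.pow_right_injective hp.two_le)
  refine h.congr fun e ↦ ?_
  simp only [Function.comp_apply]
  exact term_normSq_prime_pow f w hp e

/-- `Σ_{c ∣ N} c^{-s} = ∏_{p ∣ N} (1 + p^{-s})` for squarefree `N`. [folklore] -/
theorem sum_divisors_cpow_neg_eq_prod {N : ℕ} (hN : Squarefree N) (s : ℂ) :
    ∑ c ∈ N.divisors, (c : ℂ) ^ (-s) = ∏ p ∈ N.primeFactors, (1 + (p : ℂ) ^ (-s)) := by
  classical
  -- the multiplicative arithmetic function `n ↦ n^{-s}` (`0 ↦ 0`)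
  let F : ArithmeticFunction ℂ :=
    ⟨fun n ↦ if n = 0 then 0 else (n : ℂ) ^ (-s), if_pos rfl⟩
  have hF : ∀ n : ℕ, n ≠ 0 → F n = (n : ℂ) ^ (-s) := fun n hn ↦ if_neg hn
  have hmult : F.IsMultiplicative := by
    refine ⟨by rw [hF 1 one_ne_zero, Nat.cast_one, Complex.one_cpow], fun {m n} _ ↦ ?_⟩
    rcases eq_or_ne m 0 with rfl | hm
    · simp [F]
    rcases eq_or_ne n 0 with rfl | hn
    · simp [F]
    rw [hF _ (mul_ne_zero hm hn), hF m hm, hF n hn, Nat.cast_mul, Complex.natCast_mul_natCast_cpow]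
  have key := hmult.prodPrimeFactors_one_add_of_squarefree hN
  have lhs : ∏ p ∈ N.primeFactors, (1 + F p) = ∏ p ∈ N.primeFactors, (1 + (p : ℂ) ^ (-s)) :=
    Finset.prod_congr rfl fun p hp ↦ by rw [hF p (Nat.prime_of_mem_primeFactors hp).ne_zero]
  have rhs : ∑ d ∈ N.divisors, F d = ∑ c ∈ N.divisors, (c : ℂ) ^ (-s) :=
    Finset.sum_congr rfl fun d hd ↦ by rw [hF d (Nat.pos_of_mem_divisors hd).ne']
  rw [← rhs, ← key, lhs]

/-- Partial products of a convergent product of reals `≥ 1` are bounded by its value. [folklore] -/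
theorem prod_le_of_hasProd_of_one_le {ι : Type*} {g : ι → ℝ} {a : ℝ} (h : HasProd g a)
    (h1 : ∀ i, 1 ≤ g i) (S : Finset ι) : ∏ i ∈ S, g i ≤ a := by
  have ht : Tendsto (fun T : Finset ι ↦ ∏ i ∈ T, g i) atTop (𝓝 a) := h
  refine ge_of_tendsto ht (Filter.eventually_atTop.2 ⟨S, fun T hST ↦ ?_⟩)
  exact Finset.prod_le_prod_of_subset_of_one_le hST
    (fun i _ ↦ zero_le_one.trans (h1 i)) (fun i _ _ ↦ h1 i)

/-- `0 < 1 − q^{-t}` and `1 ≤ (1 − q^{-t})⁻¹` for a prime `q` and `t > 0`. [folklore] -/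
theorem one_sub_prime_rpow_neg_pos {q : ℕ} (hq : q.Prime) {t : ℝ} (ht : 0 < t) :
    0 < 1 - (q : ℝ) ^ (-t) ∧ 1 ≤ (1 - (q : ℝ) ^ (-t))⁻¹ := by
  have hq1 : (1 : ℝ) < q := by exact_mod_cast hq.one_lt
  have hlt : (q : ℝ) ^ (-t) < 1 := Real.rpow_lt_one_of_one_lt_of_neg hq1 (by linarith)
  have hnn : 0 ≤ (q : ℝ) ^ (-t) := Real.rpow_nonneg (by positivity) _
  refine ⟨by linarith, ?_⟩
  rw [one_le_inv₀ (by linarith)]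
  linarith

/-- `Σ_{n ≥ 1} n^{-x} ≤ 2` for real `x ≥ 2` (`≤ ζ(2) = π²/6`). [folklore] -/
theorem tsum_one_div_nat_rpow_le_two {x : ℝ} (hx : 2 ≤ x) : ∑' n : ℕ, 1 / (n : ℝ) ^ x ≤ 2 := by
  have hsum2 : Summable fun n : ℕ ↦ 1 / (n : ℝ) ^ (2 : ℝ) :=
    Real.summable_one_div_nat_rpow.mpr (by norm_num)
  have hsumx : Summable fun n : ℕ ↦ 1 / (n : ℝ) ^ x := Real.summable_one_div_nat_rpow.mpr (by linarith)
  have hle : ∀ n : ℕ, 1 / (n : ℝ) ^ x ≤ 1 / (n : ℝ) ^ (2 : ℝ) := by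
    intro n
    rcases Nat.eq_zero_or_pos n with rfl | hn
    · simp [Real.zero_rpow (by linarith : x ≠ 0), Real.zero_rpow (by norm_num : (2 : ℝ) ≠ 0)]
    · have hn1 : (1 : ℝ) ≤ n := by exact_mod_cast hn
      exact one_div_le_one_div_of_le (by positivity) (Real.rpow_le_rpow_of_exponent_le hn1 hx)
  calc ∑' n : ℕ, 1 / (n : ℝ) ^ x ≤ ∑' n : ℕ, 1 / (n : ℝ) ^ (2 : ℝ) := hsumx.tsum_le_tsum hle hsum2
    _ = π ^ 2 / 6 := tsum_one_div_nat_rpow_two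
    _ ≤ 2 := by nlinarith [Real.pi_lt_d2, Real.pi_pos]

/-- **The key bound on the line of absolute convergence.** For squarefree `N`, the newform `f` of an
elliptic curve `E/ℚ` of level `N` and `Re s = σ > 1`,

  `‖(Σ_{c∣N} c^{-s}) · Σₙ |aₙ(f)|² n^{-(s+1)}‖ ≤ ζ(2σ) ζ(σ)³ ζ(σ+1) · ‖ζ(s)‖`

(real `ζ(x) = Σ n^{-x}` on the right except for the last, complex, factor). Proof: the Euler product
`Σ |aₙ|² n^{-s-1} = ∏_{p∤N} (1 + p^{-s}) L_p(Sym² f, s) · ∏_{p∣N} (1 − p^{-1-s})⁻¹` with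
`|L_p(Sym² f, s)| ≤ (1 − p^{-σ})⁻³` (Hasse: unitary Satake parameters) and, `N` being squarefree,
`Σ_{c∣N} c^{-s} = ∏_{p∣N}(1 + p^{-s})`, which COMPLETES `∏_{p∤N}(1 + p^{-s})` to
`∏_p (1 + p^{-s}) = ζ(s)/ζ(2s)`; finally `|1 + p^{-s}| ≤ (1 + p^{-2σ})|1 − p^{-s}|⁻¹`. This is the
estimate `|L(σ + it)| ≪ ζ(σ)^d` (`d = 3`) of hypothesis (ii) in Rademacher's Proposition as used in
[MaiMurty1994], §2 for `L(s, Sym² f)`, transported to the Rankin–Selberg Dirichlet series of the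
tree's trace zeta function: the pole factor `ζ(s)` is kept as the complex `‖ζ(s)‖` (to be paired
with `s − 1`), so that only THREE real zeta factors `ζ(σ)` — Mai–Murty's `(log N)³` — remain.
[cite: MaiMurty1994, §2 (Proposition (Rademacher), hypothesis (ii) with d = 3 for Sym² f)] -/
theorem _root_.Literature.NumberTheory.EllipticCurves.ModularForms.IsNewformOf.norm_sum_divisors_mul_LSeries_le
    (hN : Squarefree N) (hf : IsNewformOf W f) {s : ℂ} (hs : 1 < s.re) :
    ‖(∑ c ∈ N.divisors, (c : ℂ) ^ (-s)) * LSeries (fun n ↦ (((‖cuspCoeff f n‖ ^ 2 : ℝ)) : ℂ)) (s + 1)‖ ≤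
      (∑' n : ℕ, 1 / (n : ℝ) ^ (2 * s.re)) * (∑' n : ℕ, 1 / (n : ℝ) ^ s.re) ^ 3 *
        (∑' n : ℕ, 1 / (n : ℝ) ^ (s.re + 1)) * ‖riemannZeta s‖ := by
  set σ : ℝ := s.re with hσdef
  have hσ1 : 1 < σ := hs
  set g : ℕ → ℂ := fun n ↦ (((‖cuspCoeff f n‖ ^ 2 : ℝ)) : ℂ) with hg
  have hw : 2 < (s + 1).re := by
    simp only [Complex.add_re, Complex.one_re]
    linarith
  have hN0 : N ≠ 0 := NeZero.ne N
  obtain ⟨S₀, hS₀⟩ := exists_finset_primes_mem_iff_dvd hN0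
  -- (1) Euler products in norm: `‖L‖ = ∏ ‖T_p‖`, `‖ζ(s)‖ = ∏ ‖(1 - p^{-s})⁻¹‖`
  set T : Nat.Primes → ℂ := fun p ↦
    ∑' e : ℕ, (((‖cuspCoeff f ((p : ℕ) ^ e)‖ ^ 2 : ℝ)) : ℂ) * (((p : ℕ) : ℂ) ^ (-(s + 1))) ^ e
    with hT
  have hE : HasProd (fun p ↦ ‖T p‖) ‖LSeries g (s + 1)‖ := (hf.1.hasProd_LSeries_normSq hw).norm
  set z : Nat.Primes → ℝ := fun p ↦ ‖(1 - ((p : ℕ) : ℂ) ^ (-s))⁻¹‖ with hz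
  have hZ : HasProd z ‖riemannZeta s‖ := (riemannZeta_eulerProduct_hasProd hs).norm
  -- (2) the correction factor at the primes dividing `N`
  set c : Nat.Primes → ℝ := fun p ↦ if (p : ℕ) ∣ N then ‖1 + ((p : ℕ) : ℂ) ^ (-s)‖ else 1 with hc
  have hc_of_not : ∀ p : Nat.Primes, ¬ (p : ℕ) ∣ N → c p = 1 := fun p hp ↦ by
    simp only [hc, if_neg hp]
  have hc_of : ∀ p : Nat.Primes, (p : ℕ) ∣ N → c p = ‖1 + ((p : ℕ) : ℂ) ^ (-s)‖ := fun p hp ↦ by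
    simp only [hc, if_pos hp]
  have hc0 : ∀ p, 0 ≤ c p := fun p ↦ by
    by_cases hp : (p : ℕ) ∣ N
    · rw [hc_of p hp]; exact norm_nonneg _
    · rw [hc_of_not p hp]; exact zero_le_one
  have hC : HasProd c (∏ p ∈ S₀, c p) :=
    hasProd_prod_of_ne_finset_one fun p hp ↦ hc_of_not p (fun h ↦ hp ((hS₀ p).mpr h))
  have hCval : ∏ p ∈ S₀, c p = ‖∑ c ∈ N.divisors, (c : ℂ) ^ (-s)‖ := by
    rw [sum_divisors_cpow_neg_eq_prod hN, norm_prod]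
    have h1 : ∏ p ∈ S₀, c p = ∏ p ∈ S₀, ‖1 + ((p : ℕ) : ℂ) ^ (-s)‖ :=
      Finset.prod_congr rfl fun p hp ↦ hc_of p ((hS₀ p).mp hp)
    rw [h1]
    exact prod_finset_primes_eq_prod_primeFactors hN0 hS₀ (fun q : ℕ ↦ ‖1 + (q : ℂ) ^ (-s)‖)
  -- (3) the real majorants `v_p` with `∏ v_p = ζ(2σ) ζ(σ)³ ζ(σ+1)`
  set K : ℝ := (∑' n : ℕ, 1 / (n : ℝ) ^ (2 * σ)) * (∑' n : ℕ, 1 / (n : ℝ) ^ σ) ^ 3 *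
    (∑' n : ℕ, 1 / (n : ℝ) ^ (σ + 1)) with hK
  set v : Nat.Primes → ℝ := fun p ↦ (1 - (p : ℝ) ^ (-(2 * σ)))⁻¹ * ((1 - (p : ℝ) ^ (-σ))⁻¹) ^ 3 *
    (1 - (p : ℝ) ^ (-(σ + 1)))⁻¹ with hv
  have hV : HasProd v K :=
    ((hasProd_one_sub_prime_rpow_neg_inv (s := 2 * σ) (by linarith)).mul
      ((hasProd_one_sub_prime_rpow_neg_inv hσ1).pow 3)).mul
      (hasProd_one_sub_prime_rpow_neg_inv (s := σ + 1) (by linarith))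
  have hA2 : ∀ p : Nat.Primes, 0 < 1 - (p : ℝ) ^ (-(2 * σ)) ∧ 1 ≤ (1 - (p : ℝ) ^ (-(2 * σ)))⁻¹ :=
    fun p ↦ one_sub_prime_rpow_neg_pos p.2 (by linarith)
  have hB : ∀ p : Nat.Primes, 0 < 1 - (p : ℝ) ^ (-σ) ∧ 1 ≤ (1 - (p : ℝ) ^ (-σ))⁻¹ :=
    fun p ↦ one_sub_prime_rpow_neg_pos p.2 (by linarith)
  have hB1 : ∀ p : Nat.Primes, 0 < 1 - (p : ℝ) ^ (-(σ + 1)) ∧ 1 ≤ (1 - (p : ℝ) ^ (-(σ + 1)))⁻¹ :=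
    fun p ↦ one_sub_prime_rpow_neg_pos p.2 (by linarith)
  have hv1 : ∀ p, 1 ≤ v p := fun p ↦ by
    have h3 : (1 : ℝ) ≤ ((1 - (p : ℝ) ^ (-σ))⁻¹) ^ 3 := one_le_pow₀ (hB p).2
    calc (1 : ℝ) = 1 * 1 * 1 := by ring
      _ ≤ v p := mul_le_mul (mul_le_mul (hA2 p).2 h3 zero_le_one (zero_le_one.trans (hA2 p).2))
          (hB1 p).2 zero_le_one (mul_nonneg (zero_le_one.trans (hA2 p).2) (zero_le_one.trans h3))
  have hVle : ∀ S : Finset Nat.Primes, ∏ p ∈ S, v p ≤ K := prod_le_of_hasProd_of_one_le hV hv1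
  -- (4) the pointwise bound `‖T_p‖ c_p ≤ z_p v_p`
  have hpt : ∀ p : Nat.Primes, ‖T p‖ * c p ≤ z p * v p := by
    intro p
    have hq : (p : ℕ).Prime := p.2
    have hq0 : (0 : ℝ) < (p : ℕ) := by exact_mod_cast hq.pos
    have hq1 : (1 : ℝ) < (p : ℕ) := by exact_mod_cast hq.one_lt
    have hqC : ((p : ℕ) : ℂ) ≠ 0 := by exact_mod_cast hq.ne_zero
    set X : ℂ := ((p : ℕ) : ℂ) ^ (-(s + 1)) with hX
    set ws : ℂ := ((p : ℕ) : ℂ) ^ (-s) with hws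
    set y : ℝ := (p : ℝ) ^ (-σ) with hy
    have hy0 : 0 ≤ y := Real.rpow_nonneg hq0.le _
    have hy1 : y < 1 := Real.rpow_lt_one_of_one_lt_of_neg hq1 (by linarith)
    have hws_norm : ‖ws‖ = y := by
      rw [hws, Complex.norm_natCast_cpow_of_pos hq.pos, Complex.neg_re]
    have hpX : ((p : ℕ) : ℂ) * X = ws := by
      rw [hX, hws, show -(s + 1) = -s + (-1) by ring, Complex.cpow_add _ _ hqC, Complex.cpow_neg_one]
      field_simp
    have hpXn : (p : ℕ) * ‖X‖ = y := by
      rw [← hws_norm, ← hpX, norm_mul, Complex.norm_natCast]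
    have hXn : ‖X‖ = (p : ℝ) ^ (-(σ + 1)) := by
      rw [hX, Complex.norm_natCast_cpow_of_pos hq.pos]
      congr 1
    have hXlt : ‖X‖ < 1 := by
      rw [hXn]; exact Real.rpow_lt_one_of_one_lt_of_neg hq1 (by linarith)
    have hy2 : y ^ 2 = (p : ℝ) ^ (-(2 * σ)) := by
      rw [hy, ← Real.rpow_natCast, ← Real.rpow_mul hq0.le]
      congr 1; push_cast; ring
    -- `‖1 + p^{-s}‖ ≤ (1 − p^{-2σ})⁻¹ z_p`
    have hplus : ‖1 + ws‖ ≤ (1 - (p : ℝ) ^ (-(2 * σ)))⁻¹ * z p := by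
      have h := norm_one_add_le_mul_norm_inv_one_sub (w := ws) (by rw [hws_norm]; exact hy1)
      rw [hws_norm, hy2] at h
      refine h.trans (mul_le_mul_of_nonneg_right ?_ (norm_nonneg _))
      -- `1 + t ≤ (1 − t)⁻¹` for `t = p^{-2σ} ∈ [0, 1)`
      have ht0 : 0 ≤ (p : ℝ) ^ (-(2 * σ)) := Real.rpow_nonneg hq0.le _
      have ht1 : (p : ℝ) ^ (-(2 * σ)) < 1 := by rw [← hy2]; nlinarith
      rw [inv_eq_one_div, le_div_iff₀ (by linarith)]
      nlinarith
    have hsT : Summable fun e : ℕ ↦ (((‖cuspCoeff f ((p : ℕ) ^ e)‖ ^ 2 : ℝ)) : ℂ) * X ^ e :=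
      summable_normSq_cuspCoeff_prime_pow_mul_cpow f hw hq
    have hzv : z p * v p = ((1 - (p : ℝ) ^ (-(2 * σ)))⁻¹ * z p) * ((1 - y)⁻¹) ^ 3 *
        (1 - (p : ℝ) ^ (-(σ + 1)))⁻¹ := by rw [hv]; ring
    rw [hzv]
    by_cases hpN : (p : ℕ) ∣ N
    · -- bad prime `p ∥ N`
      have hp2 : ¬ (p : ℕ) ^ 2 ∣ N := by
        rw [pow_two]; exact Nat.squarefree_iff_prime_squarefree.mp hN _ hq
      have hTle : ‖T p‖ ≤ (1 - (p : ℝ) ^ (-(σ + 1)))⁻¹ := by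
        have h := hf.1.norm_tsum_normSq_mul_pow_le_of_dvd hq hpN hp2 hXlt
        rwa [hXn] at h
      rw [hc_of p hpN]
      have h3 : (1 : ℝ) ≤ ((1 - y)⁻¹) ^ 3 := by
        have : (1 : ℝ) ≤ (1 - y)⁻¹ := by rw [one_le_inv₀ (by linarith)]; linarith
        exact one_le_pow₀ this
      calc ‖T p‖ * ‖1 + ws‖ ≤ (1 - (p : ℝ) ^ (-(σ + 1)))⁻¹ * ((1 - (p : ℝ) ^ (-(2 * σ)))⁻¹ * z p) :=
            mul_le_mul hTle hplus (norm_nonneg _) (zero_le_one.trans (hB1 p).2)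
        _ = ((1 - (p : ℝ) ^ (-(2 * σ)))⁻¹ * z p) * 1 * (1 - (p : ℝ) ^ (-(σ + 1)))⁻¹ := by ring
        _ ≤ ((1 - (p : ℝ) ^ (-(2 * σ)))⁻¹ * z p) * ((1 - y)⁻¹) ^ 3 * (1 - (p : ℝ) ^ (-(σ + 1)))⁻¹ := by
            gcongr
            · exact zero_le_one.trans (hB1 p).2
            · exact mul_nonneg (zero_le_one.trans (hA2 p).2) (norm_nonneg _)
    · -- good prime `p ∤ N`
      have hTle : ‖T p‖ ≤ ‖1 + ws‖ * ((1 - y)⁻¹) ^ 3 := by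
        have h := hf.norm_tsum_normSq_mul_pow_le_of_not_dvd hq hpN (x := X) (by rw [hpXn]; exact hy1) hsT
        rwa [hpX, hpXn] at h
      rw [hc_of_not p hpN, mul_one]
      have h3 : (0 : ℝ) ≤ ((1 - y)⁻¹) ^ 3 := pow_nonneg (inv_nonneg.mpr (by linarith)) 3
      calc ‖T p‖ ≤ ‖1 + ws‖ * ((1 - y)⁻¹) ^ 3 := hTle
        _ ≤ ((1 - (p : ℝ) ^ (-(2 * σ)))⁻¹ * z p) * ((1 - y)⁻¹) ^ 3 :=
            mul_le_mul_of_nonneg_right hplus h3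
        _ = ((1 - (p : ℝ) ^ (-(2 * σ)))⁻¹ * z p) * ((1 - y)⁻¹) ^ 3 * 1 := (mul_one _).symm
        _ ≤ ((1 - (p : ℝ) ^ (-(2 * σ)))⁻¹ * z p) * ((1 - y)⁻¹) ^ 3 * (1 - (p : ℝ) ^ (-(σ + 1)))⁻¹ := by
            gcongr
            · exact mul_nonneg (mul_nonneg (zero_le_one.trans (hA2 p).2) (norm_nonneg _)) h3
            · exact (hB1 p).2
  -- (5) partial products and the limit
  have hlim1 : Tendsto (fun S : Finset Nat.Primes ↦ ∏ p ∈ S, ‖T p‖ * c p) atTop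
      (𝓝 (‖LSeries g (s + 1)‖ * ∏ p ∈ S₀, c p)) := hE.mul hC
  have hlim2 : Tendsto (fun S : Finset Nat.Primes ↦ (∏ p ∈ S, z p) * K) atTop
      (𝓝 (‖riemannZeta s‖ * K)) := by
    have hZt : Tendsto (fun S : Finset Nat.Primes ↦ ∏ p ∈ S, z p) atTop (𝓝 ‖riemannZeta s‖) := hZ
    exact hZt.mul_const K
  have hle : ∀ S : Finset Nat.Primes, ∏ p ∈ S, ‖T p‖ * c p ≤ (∏ p ∈ S, z p) * K := fun S ↦ by
    calc ∏ p ∈ S, ‖T p‖ * c p ≤ ∏ p ∈ S, z p * v p :=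
          Finset.prod_le_prod (fun p _ ↦ mul_nonneg (norm_nonneg _) (hc0 p)) (fun p _ ↦ hpt p)
      _ = (∏ p ∈ S, z p) * ∏ p ∈ S, v p := Finset.prod_mul_distrib
      _ ≤ (∏ p ∈ S, z p) * K :=
          mul_le_mul_of_nonneg_left (hVle S) (Finset.prod_nonneg fun p _ ↦ norm_nonneg _)
  have hfinal := le_of_tendsto_of_tendsto' hlim1 hlim2 hle
  rw [norm_mul, ← hCval, mul_comm]
  calc ‖LSeries g (s + 1)‖ * ∏ p ∈ S₀, c p ≤ ‖riemannZeta s‖ * K := hfinal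
    _ = K * ‖riemannZeta s‖ := mul_comm _ _

end Euler

/-! ### 3. The Phragmén–Lindelöf bound with exponent `3` -/

section Main

/-- On `Re z ≥ 1`: `‖z − 1‖ · ‖ζ(z)‖ ≤ 2 ‖z + 2‖²`, uniformly (the pole of `ζ` at `1` is simple:
`‖ζ(z)‖ ≤ ‖z‖/‖z − 1‖ + ‖z‖/Re z`, the tree's `norm_riemannZeta_le_of_re_pos`, Titchmarsh (2.12.2)).
This replaces the real majorant `ζ(1 + δ) ≍ 1/δ` of the pole factor of the Rankin–Selberg series by
polynomial growth in `Im z`, which the Phragmén–Lindelöf principle absorbs. [folklore] -/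
theorem norm_sub_one_mul_norm_riemannZeta_le {z : ℂ} (hz : 1 ≤ z.re) (hz1 : z ≠ 1) :
    ‖z - 1‖ * ‖riemannZeta z‖ ≤ 2 * ‖z + 2‖ ^ 2 := by
  have h := norm_riemannZeta_le_of_re_pos (s := z) (by linarith) hz1
  have hz1' : 0 < ‖z - 1‖ := norm_pos_iff.mpr (sub_ne_zero.mpr hz1)
  have b1 : ‖z‖ ≤ ‖z + 2‖ := norm_le_norm_add_two (by linarith)
  have b2 : ‖z - 1‖ ≤ ‖z + 2‖ := norm_sub_one_le_norm_add_two (by linarith)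
  have h3 : (1 : ℝ) ≤ ‖z + 2‖ := by
    have := Complex.re_le_norm (z + 2)
    rw [Complex.add_re, Complex.re_ofNat] at this
    linarith
  have hdiv : ‖z‖ / z.re ≤ ‖z‖ := div_le_self (norm_nonneg _) hz
  calc ‖z - 1‖ * ‖riemannZeta z‖ ≤ ‖z - 1‖ * (‖z‖ / ‖z - 1‖ + ‖z‖ / z.re) :=
        mul_le_mul_of_nonneg_left h (norm_nonneg _)
    _ = ‖z‖ + ‖z - 1‖ * (‖z‖ / z.re) := by field_simp
    _ ≤ ‖z + 2‖ + ‖z + 2‖ * ‖z + 2‖ := by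
        gcongr
        exact hdiv.trans b1
    _ ≤ 2 * ‖z + 2‖ ^ 2 := by nlinarith

variable {N : ℕ} [NeZero N] {W : WeierstrassCurve ℚ} [W.IsElliptic] {f : CuspForm (Gamma0 N) 2}

/-- **The key bound on the line `Re s = 1 + δ` in the form used**: for squarefree `N`, the newform `f`
of `E/ℚ`, `0 < δ ≤ 1/2` and `Re s = 1 + δ`,
`‖(Σ_{c∣N} c^{-s}) Σ|aₙ|²n^{-(s+1)}‖ ≤ 4 ζ(1+δ)³ ‖ζ(s)‖` (`ζ(2+2δ), ζ(2+δ) ≤ ζ(2) ≤ 2`).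
[cite: MaiMurty1994, §2 (Proposition (Rademacher), hypothesis (ii) with d = 3 for Sym² f)] -/
theorem _root_.Literature.NumberTheory.EllipticCurves.ModularForms.IsNewformOf.norm_sum_divisors_mul_LSeries_le_four_mul
    (hN : Squarefree N) (hf : IsNewformOf W f) {δ : ℝ} (hδ : 0 < δ) {s : ℂ} (hs : s.re = 1 + δ) :
    ‖(∑ c ∈ N.divisors, (c : ℂ) ^ (-s)) * LSeries (fun n ↦ (((‖cuspCoeff f n‖ ^ 2 : ℝ)) : ℂ)) (s + 1)‖ ≤
      4 * (∑' n : ℕ, 1 / (n : ℝ) ^ (1 + δ)) ^ 3 * ‖riemannZeta s‖ := by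
  have hs1 : 1 < s.re := by rw [hs]; linarith
  have h := hf.norm_sum_divisors_mul_LSeries_le hN hs1
  rw [hs] at h
  have h2 : ∑' n : ℕ, 1 / (n : ℝ) ^ (2 * (1 + δ)) ≤ 2 := tsum_one_div_nat_rpow_le_two (by linarith)
  have h1 : ∑' n : ℕ, 1 / (n : ℝ) ^ (1 + δ + 1) ≤ 2 := tsum_one_div_nat_rpow_le_two (by linarith)
  have hζpos : 0 < ∑' n : ℕ, 1 / (n : ℝ) ^ (1 + δ) := tsum_one_div_nat_rpow_pos (by linarith)
  have h1pos : 0 ≤ ∑' n : ℕ, 1 / (n : ℝ) ^ (1 + δ + 1) := (tsum_one_div_nat_rpow_pos (by linarith)).le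
  refine h.trans ?_
  have hz0 : 0 ≤ ‖riemannZeta s‖ := norm_nonneg _
  calc (∑' n : ℕ, 1 / (n : ℝ) ^ (2 * (1 + δ))) * (∑' n : ℕ, 1 / (n : ℝ) ^ (1 + δ)) ^ 3 *
        (∑' n : ℕ, 1 / (n : ℝ) ^ (1 + δ + 1)) * ‖riemannZeta s‖
      ≤ 2 * (∑' n : ℕ, 1 / (n : ℝ) ^ (1 + δ)) ^ 3 * 2 * ‖riemannZeta s‖ := by gcongr
    _ = 4 * (∑' n : ℕ, 1 / (n : ℝ) ^ (1 + δ)) ^ 3 * ‖riemannZeta s‖ := by ring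

set_option maxHeartbeats 400000 in
/-- **The Petersson norm of the newform of a semistable elliptic curve is `≪ N (log N)³`** — the
upper half of Mai–Murty's Proposition with THEIR exponent. There is an absolute constant `C > 0`
such that for every squarefree `N ≥ 1`, every elliptic curve `E/ℚ` and every `f ∈ S₂(Γ₀(N))` with
`IsNewformOf E f`,

  `Re (f, f)_{Γ₀(N)} ≤ C · N · (1 + log N)³`.

[MaiMurty1994], §2 prints "`L(1, Sym²(f)) = O((log N)³)`" (Rademacher's Phragmén–Lindelöf theorem
for the degree-`3` Euler product `L(s, Sym² f)`, entire with `log`-conductor `O(log N)` by Shimura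
1975) and deduces "Proposition. `log⟨f,f⟩ = O(log N)`" from the Rankin–Selberg display
`L(1, Sym² f) = c π³ ∏(…) ⟨f,f⟩/N`; [MurtyCongruencePrimes1999], §2 and [PastenShimura2024], p. 49
quote it as "`(f,f) ≪ N log N`" (the named fact `murty_petersson_newform_upper_bound`, whose
exponent `1` is not established — see its caveat). The proof here is the printed convexity argument
run on the tree's continuation, as in `exists_petersson_le_mul_log_pow_of_squarefree` (exponent `5`)
but with the sharp bookkeeping on the line `Re s = 1 + δ`: by
`IsNewformOf.norm_sum_divisors_mul_LSeries_le` the trace zeta function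
`Z_f(s) = s(s−1)π^{-s}Γ(s)ζ(2s)Γ(s+1)(4π/N)^{-(s+1)} (N⁻¹Σ_{c∣N}c^{-s}) Σ|aₙ|²n^{-(s+1)}` satisfies
`|Z_f(s)| ≤ 16 N^{1+δ} ζ(1+δ)³ |s+2|⁵` there (`|s(s−1)ζ(s)| ≤ 2|s+2|³`, `|ζ(2s)| ≤ 2|s+2|`,
`|Γ(s)| ≤ 1`, `|Γ(s+1)| ≤ |s+2|`), the same on `Re s = −δ` up to `(7/3)⁵` by `Z_f(1−s) = Z_f(s)`,
whence `V/2 = Z_f(1) ≤ 3⁵ (7/3)⁵ · 16 N^{1+δ} ζ(1+δ)³` by Rademacher's theorem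
(`rademacher_phragmenLindelof_of_finiteOrder`), and `δ = 1/(2 + log N)` gives the claim with
`C = 2 · 3⁵ · (7/3)⁵ · 16 · e · 4³`. The restriction to squarefree `N` is that of the tree's
Rankin–Selberg dictionary (`IsNewform0.traceZeta_eq_of_squarefree`); for `p² ∣ N` the other cusps
contribute twisted series not available in the tree.
[cite: MaiMurty1994, §2 (L(1, Sym² f) = O((log N)³); Proposition: log⟨f,f⟩ = O(log N))] -/
theorem exists_petersson_le_mul_log_cube_of_squarefree :
    ∃ C : ℝ, 0 < C ∧ ∀ (N : ℕ) [NeZero N], Squarefree N →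
      ∀ (W : WeierstrassCurve ℚ) [W.IsElliptic] (f : CuspForm (Gamma0 N) 2), IsNewformOf W f →
        (peterssonProduct (Gamma0 N) 2 f f).re ≤ C * N * (1 + Real.log N) ^ 3 := by
  obtain ⟨Q, hQ, hQbd⟩ := exists_norm_J₀_le_uniform
  refine ⟨2 * 3 ^ 5 * (7 / 3) ^ 5 * 16 * Real.exp 1 * 4 ^ 3, by positivity, ?_⟩
  intro N _ hN W _ f hf
  have hπ := Real.pi_pos
  have hN0 : (0 : ℝ) < N := Nat.cast_pos.mpr (NeZero.pos N)
  have hN1 : (1 : ℝ) ≤ N := by exact_mod_cast NeZero.one_le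
  have hlogN : 0 ≤ Real.log N := Real.log_nonneg hN1
  -- the horocycle datum of the trace `G_f` (as in `NewformPeterssonSizeSiegelProofs`)
  have hGc : Continuous (rsTrace N 2 f) := continuous_rsTrace (ModularFormClass.continuous f)
  have hGinv : ∀ (A : SL(2, ℤ)) (τ : UpperHalfPlane), rsTrace N 2 f (A • τ) = rsTrace N 2 f τ :=
    fun A τ ↦ rsTrace_smul f A τ
  have hG0 : ∀ τ, 0 ≤ rsTrace N 2 f τ := fun τ ↦ rsTrace_nonneg _ τ
  obtain ⟨B, -, hB⟩ := exists_rsTrace_le f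
  have hC : ∀ n, 0 ≤ rsCoeff N 2 f n := fun n ↦ rsCoeff_nonneg _ n
  have hC0 : rsCoeff N 2 f 0 = 0 := rsCoeff_zero f
  set a : ℝ := 4 * π / N with hadef
  have ha : 0 < a := by positivity
  have hs : ∀ y : ℝ, 0 < y → Summable fun n : ℕ ↦ rsCoeff N 2 f n * Real.exp (-a * n * y) :=
    fun y hy ↦ summable_rsCoeff_mul_exp_datum f hy
  have hm : ∀ y : ℝ, 0 < y → ∫ x in (0 : ℝ)..1, rsTrace N 2 f (pt x y) =
      y ^ (2 : ℝ) * ∑' n : ℕ, rsCoeff N 2 f n * Real.exp (-a * n * y) :=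
    fun y hy ↦ horocycle_rsTrace_datum f hy
  have hκ : (0 : ℝ) ≤ 2 := by norm_num
  -- `J`, `V`, `Z`
  set J : ℂ → ℂ := fun s ↦ ∫ w in ModularGroup.fd, (rsTrace N 2 f w : ℂ) * completedEisenstein₀ w s
    with hJdef
  set V : ℝ := ∫ w in ModularGroup.fd, rsTrace N 2 f w with hVdef
  have hVeq : (peterssonProduct (Gamma0 N) 2 f f).re = V :=
    peterssonProduct_self_re_eq_integral_rsTrace f
  have hV0 : 0 ≤ V := setIntegral_nonneg ModularGroup.isClosed_fd.measurableSet fun w _ ↦ hG0 w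
  have hJ : Differentiable ℂ J := differentiable_J₀ hGc hGinv hG0 hB hC hC0 ha hκ hs hm
  have hJbd : ∀ s : ℂ, -1 / 2 ≤ s.re → s.re ≤ 7 / 2 → ‖J s‖ ≤ Q * (1 + a⁻¹) ^ 4 * V :=
    fun s h1 h2 ↦ hQbd hGc hGinv hG0 hB hC hC0 ha hs hm h1 h2
  set M : ℝ := Q * (1 + a⁻¹) ^ 4 * V with hMdef
  have hM0 : 0 ≤ M := by positivity
  set Z : ℂ → ℂ := fun s ↦ s * (s - 1) * J s + (V : ℂ) / 2 with hZdef
  have hZdiff : Differentiable ℂ Z :=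
    ((differentiable_id.mul (differentiable_id.sub_const 1)).mul hJ).add_const _
  have hZsymm : ∀ s : ℂ, Z (1 - s) = Z s := by
    intro s
    have hJs : J (1 - s) = J s := J₀_one_sub (fun w ↦ rsTrace N 2 f w) s
    show (1 - s) * (1 - s - 1) * J (1 - s) + (V : ℂ) / 2 = s * (s - 1) * J s + (V : ℂ) / 2
    rw [hJs]; ring
  have hZone : Z 1 = (V : ℂ) / 2 := by
    show (1 : ℂ) * (1 - 1) * J 1 + (V : ℂ) / 2 = (V : ℂ) / 2
    ring
  -- finite order in the strip `-1/2 ≤ Re s ≤ 3/2`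
  have hgrowth : ∀ z : ℂ, -1 / 2 ≤ z.re → z.re ≤ 3 / 2 →
      ‖Z z‖ ≤ (4 * M + V / 2) * Real.exp (|z.im| ^ (1 : ℝ)) := by
    intro z hz1 hz2
    rw [Real.rpow_one]
    have hz : ‖z‖ ≤ 2 + |z.im| := by
      have := Complex.norm_le_abs_re_add_abs_im z
      have : |z.re| ≤ 2 := abs_le.2 ⟨by linarith, by linarith⟩
      linarith
    have hz' : ‖z - 1‖ ≤ 2 + |z.im| := by
      have := Complex.norm_le_abs_re_add_abs_im (z - 1)
      rw [Complex.sub_re, Complex.sub_im, Complex.one_re, Complex.one_im, sub_zero] at this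
      have : |z.re - 1| ≤ 2 := abs_le.2 ⟨by linarith, by linarith⟩
      linarith
    have hexp := two_add_sq_le_four_mul_exp (abs_nonneg z.im)
    have h1e : 1 ≤ Real.exp |z.im| := Real.one_le_exp (abs_nonneg _)
    have hVn : ‖(V : ℂ) / 2‖ = V / 2 := by
      rw [norm_div, Complex.norm_real, Complex.norm_ofNat, Real.norm_of_nonneg hV0]
    calc ‖Z z‖ = ‖z * (z - 1) * J z + (V : ℂ) / 2‖ := rfl
      _ ≤ ‖z * (z - 1) * J z‖ + ‖(V : ℂ) / 2‖ := norm_add_le _ _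
      _ = ‖z‖ * ‖z - 1‖ * ‖J z‖ + V / 2 := by rw [norm_mul, norm_mul, hVn]
      _ ≤ (2 + |z.im|) * (2 + |z.im|) * M + V / 2 * 1 := by
          rw [mul_one]
          have hJz : ‖J z‖ ≤ M := hJbd z hz1 (by linarith)
          have h1 : ‖z‖ * ‖z - 1‖ ≤ (2 + |z.im|) * (2 + |z.im|) :=
            mul_le_mul hz hz' (norm_nonneg _) (by positivity)
          have h2 : ‖z‖ * ‖z - 1‖ * ‖J z‖ ≤ (2 + |z.im|) * (2 + |z.im|) * M :=
            mul_le_mul h1 hJz (norm_nonneg _) (by positivity)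
          linarith
      _ ≤ (4 * Real.exp |z.im|) * M + V / 2 * Real.exp |z.im| := by
          have h3 : (2 + |z.im|) * (2 + |z.im|) ≤ 4 * Real.exp |z.im| := by rw [← sq]; exact hexp
          have h4 : (2 + |z.im|) * (2 + |z.im|) * M ≤ 4 * Real.exp |z.im| * M :=
            mul_le_mul_of_nonneg_right h3 hM0
          have h5 : V / 2 * 1 ≤ V / 2 * Real.exp |z.im| := mul_le_mul_of_nonneg_left h1e (by linarith)
          linarith
      _ = (4 * M + V / 2) * Real.exp |z.im| := by ring
  -- the parameter `δ` and the real zeta value `ζ(1 + δ)`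
  set δ : ℝ := 1 / (2 + Real.log N) with hδdef
  have hδ0 : 0 < δ := by positivity
  have hδhalf : δ ≤ 1 / 2 := by
    rw [hδdef]; exact one_div_le_one_div_of_le (by norm_num) (by linarith)
  set ζδ : ℝ := ∑' n : ℕ, 1 / (n : ℝ) ^ (1 + δ) with hζδdef
  have hζδpos : 0 < ζδ := tsum_one_div_nat_rpow_pos (by linarith)
  have hζδle : ζδ ≤ 4 + Real.log N := by
    have h := tsum_one_div_nat_rpow_le (σ := 1 + δ) (by linarith)
    have hδne : δ ≠ 0 := hδ0.ne'
    have e1 : (1 + δ) / (1 + δ - 1) + 1 = 2 + 1 / δ := by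
      rw [show (1 : ℝ) + δ - 1 = δ by ring]; field_simp; ring
    have e2 : 1 / δ = 2 + Real.log N := by rw [hδdef, one_div_one_div]
    linarith
  have hNδ : (N : ℝ) ^ δ ≤ Real.exp 1 := by
    rw [Real.rpow_def_of_pos hN0]
    refine Real.exp_le_exp.2 ?_
    rw [hδdef, mul_one_div]
    exact div_le_one_of_le₀ (by linarith) (by linarith)
  -- the bound on the line `Re s = 1 + δ`
  set A₀ : ℝ := 16 * (N * (N : ℝ) ^ δ) * ζδ ^ 3 with hA₀def
  have hA₀pos : 0 < A₀ := by positivity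
  have hright : ∀ z : ℂ, z.re = 1 + δ → ‖Z z‖ ≤ A₀ * ‖z + 2‖ ^ 5 := by
    intro z hz
    have hz1 : 1 < z.re := by rw [hz]; linarith
    have hzne : z ≠ 1 := fun h ↦ by rw [h, Complex.one_re] at hz1; exact lt_irrefl _ hz1
    have hZeq : Z z = z * (z - 1) * ((π : ℂ) ^ (-z) * Complex.Gamma z * riemannZeta (2 * z) *
          (Complex.Gamma (z + 1) * (((4 * π / N : ℝ)) : ℂ) ^ (-(z + 1)))) *
        (((N : ℂ)⁻¹ * ∑ c ∈ N.divisors, (c : ℂ) ^ (-z)) *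
          LSeries (fun n ↦ (((‖cuspCoeff f n‖ ^ 2 : ℝ)) : ℂ)) (z + 1)) :=
      hf.1.traceZeta_eq_of_squarefree hN hz1
    have hZeq' : Z z = z * ((π : ℂ) ^ (-z) * Complex.Gamma z * riemannZeta (2 * z) *
          (Complex.Gamma (z + 1) * (((4 * π / N : ℝ)) : ℂ) ^ (-(z + 1)))) * (N : ℂ)⁻¹ *
        ((z - 1) * ((∑ c ∈ N.divisors, (c : ℂ) ^ (-z)) *
          LSeries (fun n ↦ (((‖cuspCoeff f n‖ ^ 2 : ℝ)) : ℂ)) (z + 1))) := by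
      rw [hZeq]; ring
    -- the factors
    have b1 : ‖z‖ ≤ ‖z + 2‖ := norm_le_norm_add_two (by linarith)
    have b3 : ‖(π : ℂ) ^ (-z)‖ ≤ 1 :=
      norm_ofReal_cpow_neg_le_one (by linarith [Real.pi_gt_three]) (by linarith)
    have b4 : ‖Complex.Gamma z‖ ≤ 1 := norm_Gamma_le_one (by linarith) (by linarith)
    have b5 : ‖riemannZeta (2 * z)‖ ≤ 2 * ‖z + 2‖ := by
      have h := norm_riemannZeta_two_mul_le (s := z) (by linarith)
      have h3 : (3 : ℝ) ≤ ‖z + 2‖ := by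
        have := Complex.re_le_norm (z + 2)
        rw [Complex.add_re, Complex.re_ofNat] at this
        linarith
      linarith
    have b6 : ‖Complex.Gamma (z + 1)‖ ≤ ‖z + 2‖ := by
      have hz0 : z ≠ 0 := fun h ↦ by rw [h, Complex.zero_re] at hz1; linarith
      rw [Complex.Gamma_add_one z hz0, norm_mul]
      calc ‖z‖ * ‖Complex.Gamma z‖ ≤ ‖z + 2‖ * 1 := by gcongr
        _ = ‖z + 2‖ := mul_one _
    have b7 : ‖(((4 * π / N : ℝ)) : ℂ) ^ (-(z + 1))‖ ≤ N * (N * (N : ℝ) ^ δ) := by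
      have h := norm_cpow_level_le (NeZero.pos N) (s := z) (by linarith)
      rw [hz, Real.rpow_add hN0, Real.rpow_one] at h
      exact h
    have b8 : ‖(N : ℂ)⁻¹‖ = (N : ℝ)⁻¹ := by rw [norm_inv, Complex.norm_natCast]
    -- the key bound and the pole factor
    have b9 : ‖(∑ c ∈ N.divisors, (c : ℂ) ^ (-z)) *
        LSeries (fun n ↦ (((‖cuspCoeff f n‖ ^ 2 : ℝ)) : ℂ)) (z + 1)‖ ≤ 4 * ζδ ^ 3 * ‖riemannZeta z‖ :=
      hf.norm_sum_divisors_mul_LSeries_le_four_mul hN hδ0 hz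
    have b10 : ‖z - 1‖ * ‖riemannZeta z‖ ≤ 2 * ‖z + 2‖ ^ 2 :=
      norm_sub_one_mul_norm_riemannZeta_le (by linarith) hzne
    have b11 : ‖(z - 1) * ((∑ c ∈ N.divisors, (c : ℂ) ^ (-z)) *
        LSeries (fun n ↦ (((‖cuspCoeff f n‖ ^ 2 : ℝ)) : ℂ)) (z + 1))‖ ≤ 8 * ζδ ^ 3 * ‖z + 2‖ ^ 2 := by
      rw [norm_mul]
      calc ‖z - 1‖ * ‖(∑ c ∈ N.divisors, (c : ℂ) ^ (-z)) *
            LSeries (fun n ↦ (((‖cuspCoeff f n‖ ^ 2 : ℝ)) : ℂ)) (z + 1)‖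
          ≤ ‖z - 1‖ * (4 * ζδ ^ 3 * ‖riemannZeta z‖) := mul_le_mul_of_nonneg_left b9 (norm_nonneg _)
        _ = 4 * ζδ ^ 3 * (‖z - 1‖ * ‖riemannZeta z‖) := by ring
        _ ≤ 4 * ζδ ^ 3 * (2 * ‖z + 2‖ ^ 2) := by gcongr
        _ = 8 * ζδ ^ 3 * ‖z + 2‖ ^ 2 := by ring
    calc ‖Z z‖ = ‖z‖ * (‖(π : ℂ) ^ (-z)‖ * ‖Complex.Gamma z‖ * ‖riemannZeta (2 * z)‖ *
          (‖Complex.Gamma (z + 1)‖ * ‖(((4 * π / N : ℝ)) : ℂ) ^ (-(z + 1))‖)) * ‖(N : ℂ)⁻¹‖ *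
        ‖(z - 1) * ((∑ c ∈ N.divisors, (c : ℂ) ^ (-z)) *
          LSeries (fun n ↦ (((‖cuspCoeff f n‖ ^ 2 : ℝ)) : ℂ)) (z + 1))‖ := by
          rw [hZeq']; simp only [norm_mul]
      _ ≤ ‖z + 2‖ * (1 * 1 * (2 * ‖z + 2‖) * (‖z + 2‖ * (N * (N * (N : ℝ) ^ δ)))) * (N : ℝ)⁻¹ *
        (8 * ζδ ^ 3 * ‖z + 2‖ ^ 2) := by
          rw [b8]
          gcongr
      _ = A₀ * ‖z + 2‖ ^ 5 := by
          rw [hA₀def]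
          field_simp
          ring
  -- the bound on both lines, with `A = (7/3)⁵ A₀`
  set A : ℝ := (7 / 3) ^ 5 * A₀ with hAdef
  have hApos : 0 < A := by positivity
  have hA₀A : A₀ ≤ A := by
    rw [hAdef]
    have : (1 : ℝ) ≤ (7 / 3) ^ 5 := by norm_num
    nlinarith
  have hb : ∀ z : ℂ, z.re = 1 + δ → ‖Z z‖ ≤ A * ‖(2 : ℂ) + z‖ ^ (5 : ℝ) := by
    intro z hz
    rw [show (5 : ℝ) = (5 : ℕ) by norm_num, Real.rpow_natCast, add_comm (2 : ℂ) z]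
    exact (hright z hz).trans (mul_le_mul_of_nonneg_right hA₀A (by positivity))
  have ha' : ∀ z : ℂ, z.re = -δ → ‖Z z‖ ≤ A * ‖(2 : ℂ) + z‖ ^ (5 : ℝ) := by
    intro z hz
    rw [show (5 : ℝ) = (5 : ℕ) by norm_num, Real.rpow_natCast, add_comm (2 : ℂ) z]
    have hsym : Z z = Z (1 - z) := by
      have := hZsymm (1 - z); rwa [sub_sub_cancel] at this
    have h1z : (1 - z).re = 1 + δ := by simp [hz]
    have h := hright (1 - z) h1z
    have h3 : ‖1 - z + 2‖ ≤ 7 / 3 * ‖z + 2‖ := by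
      rw [show (1 : ℂ) - z + 2 = 3 - z by ring]
      exact norm_three_sub_le (by rw [hz]; linarith)
    rw [hsym]
    calc ‖Z (1 - z)‖ ≤ A₀ * ‖1 - z + 2‖ ^ 5 := h
      _ ≤ A₀ * (7 / 3 * ‖z + 2‖) ^ 5 := by gcongr
      _ = A * ‖z + 2‖ ^ 5 := by rw [hAdef]; ring
  -- Phragmén–Lindelöf at `s = 1`
  have hgr : ∀ z : ℂ, -δ < z.re → z.re < 1 + δ →
      ‖Z z‖ ≤ (4 * M + V / 2) * Real.exp (|z.im| ^ (1 : ℝ)) :=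
    fun z h1 h2 ↦ hgrowth z (by linarith) (by linarith)
  have hPL := Literature.Analysis.Complex.rademacher_phragmenLindelof_of_finiteOrder (f := Z) (a := -δ) (b := 1 + δ)
    (Q := 2) (A := A) (B := A) (α := 5) (β := 5) (C := 4 * M + V / 2) (c := 1)
    (by linarith) (by linarith) hApos hApos le_rfl hZdiff.diffContOnCl one_pos hgr ha' hb
    (z := 1) (by simp; linarith) (by simp; linarith)
  -- `‖Z 1‖ ≤ 243 A`
  have h243 : ‖((2 : ℝ) : ℂ) + 1‖ ^ (5 : ℝ) = 243 := by
    rw [show ((2 : ℝ) : ℂ) + 1 = (3 : ℝ) by push_cast; norm_num, Complex.norm_real,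
      Real.norm_of_nonneg (by norm_num : (0 : ℝ) ≤ 3), show (5 : ℝ) = (5 : ℕ) by norm_num,
      Real.rpow_natCast]
    norm_num
  have hx : 0 < A * 243 := by positivity
  have hZ1 : ‖Z 1‖ ≤ A * 243 := by
    rw [h243, Complex.one_re] at hPL
    have e : (1 + δ - 1) / (1 + δ - -δ) + (1 - -δ) / (1 + δ - -δ) = 1 := by
      rw [← add_div, show (1 : ℝ) + δ - 1 + (1 - -δ) = 1 + δ - -δ by ring,
        div_self (by linarith : (1 : ℝ) + δ - -δ ≠ 0)]
    calc ‖Z 1‖ ≤ (A * 243) ^ ((1 + δ - 1) / (1 + δ - -δ)) * (A * 243) ^ ((1 - -δ) / (1 + δ - -δ)) := hPL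
      _ = A * 243 := by rw [← Real.rpow_add hx, e, Real.rpow_one]
  -- conclusion
  have hV : V / 2 ≤ A * 243 := by
    have : ‖Z 1‖ = V / 2 := by
      rw [hZone, norm_div, Complex.norm_real, Complex.norm_ofNat, Real.norm_of_nonneg hV0]
    rw [← this]; exact hZ1
  rw [hVeq]
  have hζ3 : ζδ ^ 3 ≤ (4 * (1 + Real.log N)) ^ 3 :=
    pow_le_pow_left₀ hζδpos.le (by linarith) 3
  calc V ≤ 2 * (A * 243) := by linarith
    _ = 2 * 3 ^ 5 * (7 / 3) ^ 5 * 16 * (N * (N : ℝ) ^ δ * ζδ ^ 3) := by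
        rw [hAdef, hA₀def]; ring
    _ ≤ 2 * 3 ^ 5 * (7 / 3) ^ 5 * 16 * (N * Real.exp 1 * (4 * (1 + Real.log N)) ^ 3) := by gcongr
    _ = 2 * 3 ^ 5 * (7 / 3) ^ 5 * 16 * Real.exp 1 * 4 ^ 3 * N * (1 + Real.log N) ^ 3 := by ring

/-- **The same bound in the shape of the named fact, with Mai–Murty's exponent `3`**: an absolute
`C > 0` with `Re (f, f)_{Γ₀(N)} ≤ C · N · (log N)³` for every squarefree `N ≥ 3` and every newform
`f` of an elliptic curve over `ℚ` of level `N` (`1 + log N ≤ 2 log N` for `N ≥ 3 > e`). This is,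
for semistable curves, exactly the statement that the proof cited for
`murty_petersson_newform_upper_bound` establishes ([MaiMurty1994], §2: `(f,f) ≪ N (log N)³`);
the named fact itself asserts the exponent `1`. [cite: MaiMurty1994, §2 (Proposition: log⟨f,f⟩ = O(log N), via L(1, Sym² f) = O((log N)³))] -/
theorem exists_petersson_le_mul_log_pow_three_of_squarefree :
    ∃ C : ℝ, 0 < C ∧ ∀ (N : ℕ) [NeZero N], Squarefree N → 3 ≤ N →
      ∀ (W : WeierstrassCurve ℚ) [W.IsElliptic] (f : CuspForm (Gamma0 N) 2), IsNewformOf W f →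
        (peterssonProduct (Gamma0 N) 2 f f).re ≤ C * N * Real.log N ^ 3 := by
  obtain ⟨C, hC, h⟩ := exists_petersson_le_mul_log_cube_of_squarefree
  refine ⟨C * 2 ^ 3, by positivity, fun N _ hN hN3 W _ f hf ↦ ?_⟩
  have hN0 : (0 : ℝ) < N := Nat.cast_pos.mpr (NeZero.pos N)
  have hN3' : (3 : ℝ) ≤ N := by exact_mod_cast hN3
  have hlog1 : 1 ≤ Real.log N := by
    rw [Real.le_log_iff_exp_le hN0]
    exact (Real.exp_one_lt_d9.le.trans (by norm_num)).trans hN3'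
  have hle : 1 + Real.log N ≤ 2 * Real.log N := by linarith
  calc (peterssonProduct (Gamma0 N) 2 f f).re ≤ C * N * (1 + Real.log N) ^ 3 := h N hN W f hf
    _ ≤ C * N * (2 * Real.log N) ^ 3 := by gcongr
    _ = C * 2 ^ 3 * N * Real.log N ^ 3 := by ring

/-- **The logarithmic form**: an absolute `C` with `log Re (f, f)_{Γ₀(N)} ≤ log N + 3 log log N + C`
for every squarefree `N ≥ 3` and every newform `f` of an elliptic curve over `ℚ` of level `N` —
Pasten's "`2 log ‖f‖ ≤ log N + O(log log N)`" ([PastenShimura2024], p. 49, proof of Thm. 16.1) and the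
upper half of Murty's `(1−ε) log N < log (f,f) < (1+ε) log N` ([MurtyCongruencePrimes1999], §2),
for semistable curves, with the `log log` constant `3` of [MaiMurty1994].
[cite: PastenShimura2024, §16 p. 49 (2 log ‖f‖ ≤ log N + O(log log N))] -/
theorem exists_log_petersson_le_three_of_squarefree :
    ∃ C : ℝ, ∀ (N : ℕ) [NeZero N], Squarefree N → 3 ≤ N →
      ∀ (W : WeierstrassCurve ℚ) [W.IsElliptic] (f : CuspForm (Gamma0 N) 2), IsNewformOf W f →
        Real.log (peterssonProduct (Gamma0 N) 2 f f).re ≤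
          Real.log N + 3 * Real.log (Real.log N) + C := by
  obtain ⟨C, hC, h⟩ := exists_petersson_le_mul_log_pow_three_of_squarefree
  refine ⟨Real.log C, fun N _ hN hN3 W _ f hf ↦ ?_⟩
  have hN0 : (0 : ℝ) < N := Nat.cast_pos.mpr (NeZero.pos N)
  have hN3' : (3 : ℝ) ≤ N := by exact_mod_cast hN3
  have hlog1 : 1 ≤ Real.log N := by
    rw [Real.le_log_iff_exp_le hN0]
    exact (Real.exp_one_lt_d9.le.trans (by norm_num)).trans hN3'
  have hpos : 0 < (peterssonProduct (Gamma0 N) 2 f f).re := hf.peterssonProduct_re_pos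
  have hb := h N hN hN3 W f hf
  have hlogpos : 0 < Real.log N := by linarith
  calc Real.log (peterssonProduct (Gamma0 N) 2 f f).re ≤ Real.log (C * N * Real.log N ^ 3) :=
        Real.log_le_log hpos hb
    _ = Real.log N + 3 * Real.log (Real.log N) + Real.log C := by
        rw [Real.log_mul (by positivity) (by positivity), Real.log_mul hC.ne' hN0.ne',
          Real.log_pow]
        push_cast
        ring

/-- **The power form** (the shape consumed by the `abc` routes, which use the Petersson bound only
through `(f,f) ≪_ε N^{1+ε}`): an absolute `C > 0` with
`Re (f, f)_{Γ₀(N)} ≤ C · N^{1+ε} / ε³` for every `0 < ε ≤ 1`, every squarefree `N`, and every newform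
`f` of an elliptic curve over `ℚ` of level `N` (`1 + log N ≤ (4/ε) N^{ε/3}`). This is the upper half
of Murty's displayed `log (f,f) < (1 + ε) log N` ([MurtyCongruencePrimes1999], §2) for semistable
curves, with an explicit dependence on `ε`. [cite: MurtyCongruencePrimes1999, §2 (log (f,f) < (1+ε) log N)] -/
theorem exists_petersson_le_mul_rpow_of_squarefree :
    ∃ C : ℝ, 0 < C ∧ ∀ ε : ℝ, 0 < ε → ε ≤ 1 → ∀ (N : ℕ) [NeZero N], Squarefree N →
      ∀ (W : WeierstrassCurve ℚ) [W.IsElliptic] (f : CuspForm (Gamma0 N) 2), IsNewformOf W f →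
        (peterssonProduct (Gamma0 N) 2 f f).re ≤ C * (N : ℝ) ^ (1 + ε) / ε ^ 3 := by
  obtain ⟨C, hC, h⟩ := exists_petersson_le_mul_log_cube_of_squarefree
  refine ⟨C * 4 ^ 3, by positivity, fun ε hε hε1 N _ hN W _ f hf ↦ ?_⟩
  have hN0 : (0 : ℝ) < N := Nat.cast_pos.mpr (NeZero.pos N)
  have hN1 : (1 : ℝ) ≤ N := by exact_mod_cast NeZero.one_le
  set t : ℝ := Real.log N with ht
  have ht0 : 0 ≤ t := Real.log_nonneg hN1
  set M : ℝ := (N : ℝ) ^ (ε / 3) with hM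
  have hexp : Real.exp (ε * t / 3) = M := by
    rw [hM, Real.rpow_def_of_pos hN0, ht]; congr 1; ring
  have hM1 : 1 ≤ M := Real.one_le_rpow hN1 (by positivity)
  have h1 : ε * t / 3 + 1 ≤ M := hexp ▸ Real.add_one_le_exp (ε * t / 3)
  -- `1 + t ≤ (4/ε) M`
  have hkey : 1 + t ≤ 4 / ε * M := by
    rw [div_mul_eq_mul_div, le_div_iff₀ hε]
    nlinarith [mul_nonneg hε.le ht0]
  have hkey3 : (1 + t) ^ 3 ≤ (4 / ε * M) ^ 3 := pow_le_pow_left₀ (by linarith) hkey 3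
  have hM3 : M ^ 3 = (N : ℝ) ^ ε := by
    rw [hM, ← Real.rpow_natCast, ← Real.rpow_mul hN0.le]
    congr 1; push_cast; ring
  have hNε : (N : ℝ) * (N : ℝ) ^ ε = (N : ℝ) ^ (1 + ε) := by
    rw [Real.rpow_add hN0, Real.rpow_one]
  calc (peterssonProduct (Gamma0 N) 2 f f).re ≤ C * N * (1 + t) ^ 3 := h N hN W f hf
    _ ≤ C * N * (4 / ε * M) ^ 3 := by gcongr
    _ = C * 4 ^ 3 * ((N : ℝ) * M ^ 3) / ε ^ 3 := by field_simp
    _ = C * 4 ^ 3 * (N : ℝ) ^ (1 + ε) / ε ^ 3 := by rw [hM3, hNε]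

/-- **For the conductor of a semistable curve** (hypothesis spelled as in the `abc` routes:
no prime square divides `N`): `Re (f, f)_{Γ₀(N)} ≤ C · N · (1 + log N)³` with the absolute `C` of
`exists_petersson_le_mul_log_cube_of_squarefree`. [cite: MaiMurty1994, §2 (Proposition: log⟨f,f⟩ = O(log N))] -/
theorem exists_petersson_le_mul_log_cube_of_forall_prime_sq_not_dvd :
    ∃ C : ℝ, 0 < C ∧ ∀ (N : ℕ) [NeZero N], (∀ p : ℕ, p.Prime → ¬ p ^ 2 ∣ N) →
      ∀ (W : WeierstrassCurve ℚ) [W.IsElliptic] (f : CuspForm (Gamma0 N) 2), IsNewformOf W f →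
        (peterssonProduct (Gamma0 N) 2 f f).re ≤ C * N * (1 + Real.log N) ^ 3 := by
  obtain ⟨C, hC, h⟩ := exists_petersson_le_mul_log_cube_of_squarefree
  refine ⟨C, hC, fun N _ hsq W _ f hf ↦ h N ?_ W f hf⟩
  exact Nat.squarefree_iff_prime_squarefree.mpr fun p hp hpp ↦ hsq p hp (by rwa [pow_two])

end Main

end Literature.NumberTheory.Automorphic
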